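import Mathlib.Analysis.SpecialFunctions.Pow.Continuity
import Literature.Barriers.CriticalPhenomena.WeaklySAWCouplingFlowProduct
import Literature.Barriers.CriticalPhenomena.WeaklySAWQuadraticFlow
import HarnessLib

/-!
# The derivative of the quadratic flow in the initial condition `μ̄₀` and the exponent `γ`
# (Bauerschmidt–Brydges–Slade 2015, §8.3, the perturbative skeleton of Lemma 8.3.3 and of
# `lim_N ν_N' ∼ c(ĝ₀)/(ĝ₀𝖡_{m²})^γ`)

Continuation of `WeaklySAWCouplingFlow.lean` (`ḡ`, `ḡ_∞`), `WeaklySAWCouplingFlowProduct.lean`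
(the product formula, `prodFactor = P`, `prodFactorLim = c`) and `WeaklySAWQuadraticFlow.lean`
(`lamFac = Λ_j = L²(1 - γβ_jḡ_j)`). In the proof of Theorem 4.1 the logarithm of Theorem 1.1 is
produced in §8.3–§8.4 as follows: `∂χ̂/∂ν₀ = -m⁻⁴ lim_N ν_N'` up to smaller terms, `ν_N = L^{-2N}μ_N`,
and the `ν₀ = μ₀`-derivative of the flow obeys (Lemma 8.3.3 of the held text)
`μ̌_j' = L^{2j}(ǧ_j/g₀)^γ(c(m²,g₀) + O(χ_jǧ_j))`, proved by an induction around the product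
`Π_j = L^{2j}∏_{l<j}(1 - γβ_lǧ_l) = L^{2j}(ǧ_j/ǧ₀)^γ(1 + Γ_∞ + O(χ_jǧ_j))` (the two displays opening
that proof); hence `lim_N ν_N' = c(m²,g₀)(ǧ_∞/g₀)^γ ∼ c(ĝ₀)/(ĝ₀𝖡_{m²})^γ` (the display after the proof,
by Lemma 8.3.2, `ǧ_∞ ∼ 1/𝖡_{m²}`), and with (1.8), `𝖡_{m²} ∼ 𝖻 log m⁻²`, the power `γ = 1/4` of the
logarithm.

This file proves the PERTURBATIVE skeleton of these statements — the quadratic flow with `r_j = 0`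
and no `K`-coordinate, explicit constants, any `γ ∈ [0,1]`:
* `linear_flow_sub_eq`: two solutions of `u_{j+1} = Λ_ju_j + s_j` differ by `Π_j(u₀' - u₀)`,
  `Π_j = ∏_{l<j}Λ_l` — for the `μ̄`-equation of the quadratic flow (`Λ_j = L²(1 - γβ_jḡ_j)`, the
  inhomogeneity not depending on `μ̄`) the derivative in `μ̄₀` is exactly `Π_j` [folklore];
* `GbarHyp.prod_lamFac_eq`, `GbarHyp.prod_one_sub_eq`: `Π_j = λ^j∏_{l<j}(1 - γβ_lḡ_l)` and, by the
  product formula, `∏_{l<j}(1 - γβ_lḡ_l) = (ḡ_j/g₀)^γ/P_j` EXACTLY, with `P_j ∈ [c, 1]`,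
  `c ∈ [1 - (16/9)γBg₀, 1]`; so `λ^j(ḡ_j/g₀)^γ ≤ Π_j ≤ λ^j(ḡ_j/g₀)^γ/c` (`GbarHyp.prod_lamFac_mem`) —
  "`Π_j = L^{2j}(ǧ_j/ǧ₀)^γ(1 + Γ_∞ + O(χ_jǧ_j))`, `Γ_∞ = O(g₀)`";
* `GbarHyp.tendsto_prod_one_sub`: `λ^{-j}Π_j = ∏_{l<j}(1 - γβ_lḡ_l) → (ḡ_∞/g₀)^γ/c` as `j → ∞`
  (`ḡ_∞ > 0` for summable `β`) — the perturbative "`lim_N ν_N' = c(m²,g₀)(ǧ_∞/g₀)^γ`" (with `c(m²,g₀) ↔ 1/c` here);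
* `tendsto_rpow_gbarLim_mul_tsum`: along a family with `Σβ_j → ∞`, `g₀ → ĝ₀ > 0`,
  `(ḡ_∞/g₀)^γ · (g₀Σ_jβ_j)^γ → 1`, i.e. `(ǧ_∞/g₀)^γ ∼ (g₀𝖡_{m²})^{-γ}` — the `(ĝ₀𝖡_{m²})^{-γ}` law.

Not here: the remainder terms of Lemma 8.3.3 (`ǧ_j', ž_j', K_j'`, which need Theorem 6.4.1), the
`χ_j`-weights, and the identification `∂χ̂/∂ν₀ ↔ ν_N'` (§8.4).

## References
* R. Bauerschmidt, D. C. Brydges, G. Slade, CMP 337 (2015), §8.3 (Lemma 8.3.3 of the held text and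
  the displays around it), §8.4. [BauerschmidtBrydgesSlade2015LogCorr]
* R. Bauerschmidt, D. C. Brydges, G. Slade, Ann. Henri Poincaré 16 (2015), Lemma 2.1(iii)(a),
  Lemma 2.3. [BauerschmidtBrydgesSlade2015Flow]
-/

noncomputable section

open Filter Topology Finset
open scoped BigOperators

namespace Literature.Barriers.CriticalPhenomena

namespace CTWSAW

/-! ### Linear response of an inhomogeneous linear recursion -/

/-- Two solutions of `u_{j+1} = Λ_ju_j + s_j` differ by `(∏_{l<j}Λ_l)(u₀' - u₀)`: the derivative of
the solution in its initial value is `Π_j = ∏_{l<j}Λ_l`. For the `μ̄`-equation of the quadratic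
flow (`Λ_j = L²(1 - γβ_jḡ_j)`, `s_j = η_jḡ_j - ξ_jḡ_j² - π_jḡ_jz̄_j` independent of `μ̄`) this is the
`r = 0`, `K = 0` case of "`μ̌_j' = Π_j(1 + Σ_j)`" in the proof of Lemma 8.3.3 of the held text (there
`Σ_j` collects the non-perturbative corrections). [folklore] -/
theorem linear_flow_sub_eq {Λ s x y : ℕ → ℝ} (hx : ∀ j, x (j + 1) = Λ j * x j + s j)
    (hy : ∀ j, y (j + 1) = Λ j * y j + s j) (j : ℕ) :
    y j - x j = (∏ l ∈ range j, Λ l) * (y 0 - x 0) := by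
  induction j with
  | zero => simp
  | succ j ih => rw [hx, hy, prod_range_succ]; linear_combination Λ j * ih

namespace GbarHyp

variable {β : ℕ → ℝ} {B g₀ lam γ : ℝ} (h : GbarHyp β B g₀)
include h

/-! ### `Π_j = λ^j ∏_{l<j}(1 - γβ_lḡ_l) = λ^j (ḡ_j/g₀)^γ / P_j` -/

omit h in
/-- `Π_j = ∏_{l<j}Λ_l = λ^j∏_{l<j}(1 - γβ_lḡ_l)`.
[cite: BauerschmidtBrydgesSlade2015LogCorr, §8.3 (proof of Lemma 8.3.3 of the held text: Π_j = L^{2j}∏_{l<j}(1 - γβ_lǧ_l))] -/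
theorem prod_lamFac_eq (j : ℕ) :
    ∏ l ∈ range j, lamFac β g₀ lam γ l = lam ^ j * ∏ l ∈ range j, (1 - γ * (β l * gbar β g₀ l)) := by
  simp only [lamFac, prod_mul_distrib, prod_const, card_range]

/-- **`∏_{l<j}(1 - γβ_lḡ_l) = (ḡ_j/g₀)^γ/P_j`** exactly (`P_j = prodFactor`, the product formula
inverted). [cite: BauerschmidtBrydgesSlade2015LogCorr, §8.3 (proof of Lemma 8.3.3: Π_j = L^{2j}(ǧ_j/ǧ₀)^γ(1 + Γ_∞ + O(χ_jǧ_j)))]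
[cite: BauerschmidtBrydgesSlade2015Flow, Lemma 2.1(iii)(a)] -/
theorem prod_one_sub_eq (hγ1 : γ ≤ 1) (j : ℕ) :
    ∏ l ∈ range j, (1 - γ * (β l * gbar β g₀ l)) =
      (gbar β g₀ j / g₀) ^ γ / prodFactor β g₀ γ j := by
  have key := h.prod_inv_one_sub_eq hγ1 j
  rw [prod_inv_distrib] at key
  rw [← inv_inv (∏ l ∈ range j, (1 - γ * (β l * gbar β g₀ l))), key, mul_inv, ← Real.inv_rpow
    (div_pos h.pos (h.gbar_pos j)).le, inv_div]
  exact (div_eq_mul_inv _ _).symm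

/-- `(ḡ_j/g₀)^γ ≤ ∏_{l<j}(1 - γβ_lḡ_l) ≤ (ḡ_j/g₀)^γ/c`, `c = prodFactorLim ∈ [1 - (16/9)γBg₀, 1]`
("`(1 + Γ_∞ + O(χ_jǧ_j))`, `Γ_∞ = O(g₀)`", with explicit constants).
[cite: BauerschmidtBrydgesSlade2015LogCorr, §8.3 (proof of Lemma 8.3.3: Π_j, Γ_∞ = O(g₀))] -/
theorem prod_one_sub_mem (hγ0 : 0 ≤ γ) (hγ1 : γ ≤ 1) (j : ℕ) :
    ∏ l ∈ range j, (1 - γ * (β l * gbar β g₀ l)) ∈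
      Set.Icc ((gbar β g₀ j / g₀) ^ γ) ((gbar β g₀ j / g₀) ^ γ / prodFactorLim β g₀ γ) := by
  rw [h.prod_one_sub_eq hγ1 j]
  have hR : 0 ≤ (gbar β g₀ j / g₀) ^ γ := Real.rpow_nonneg (div_pos (h.gbar_pos j) h.pos).le _
  have hP := h.prodFactor_pos hγ1 j
  have hc := h.prodFactorLim_pos hγ0 hγ1
  constructor
  · exact (le_div_iff₀ hP).2 (mul_le_of_le_one_right hR (h.prodFactor_le_one hγ0 hγ1 j))
  · exact div_le_div_of_nonneg_left hR hc (h.prodFactorLim_le hγ1 j)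

/-- **`λ^j(ḡ_j/g₀)^γ ≤ Π_j ≤ λ^j(ḡ_j/g₀)^γ/c`** for `λ ≥ 0`: the derivative of the quadratic flow in
`μ̄₀` in the printed shape `Π_j = L^{2j}(ǧ_j/ǧ₀)^γ(1 + Γ_∞ + O(χ_jǧ_j))`.
[cite: BauerschmidtBrydgesSlade2015LogCorr, §8.3 (Lemma 8.3.3 of the held text: μ̌_j' = L^{2j}(ǧ_j/g₀)^γ(c(m²,g₀) + O(χ_jǧ_j)))] -/
theorem prod_lamFac_mem (hlam : 0 ≤ lam) (hγ0 : 0 ≤ γ) (hγ1 : γ ≤ 1) (j : ℕ) :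
    ∏ l ∈ range j, lamFac β g₀ lam γ l ∈
      Set.Icc (lam ^ j * (gbar β g₀ j / g₀) ^ γ)
        (lam ^ j * ((gbar β g₀ j / g₀) ^ γ / prodFactorLim β g₀ γ)) := by
  rw [prod_lamFac_eq]
  obtain ⟨h1, h2⟩ := h.prod_one_sub_mem hγ0 hγ1 j
  exact ⟨mul_le_mul_of_nonneg_left h1 (pow_nonneg hlam j),
    mul_le_mul_of_nonneg_left h2 (pow_nonneg hlam j)⟩

/-! ### The limit `λ^{-j}Π_j → (ḡ_∞/g₀)^γ/c` (summable `β`) -/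

/-- **`∏_{l<j}(1 - γβ_lḡ_l) → (ḡ_∞/g₀)^γ/c`** as `j → ∞` (`ḡ_∞ = lim ḡ_j`, positive when `β` is
summable, `GbarHyp.gbarLim_pos`): the perturbative form of "`lim_{N→∞} ν_N' = c(m²,g₀)(ǧ_∞/g₀)^γ`"
(`ν_N' = L^{-2N}μ_N'`).
[cite: BauerschmidtBrydgesSlade2015LogCorr, §8.3 (the display lim_N ν_N' = c(m²,g₀)(ǧ_∞/g₀)^γ after Lemma 8.3.3)] -/
theorem tendsto_prod_one_sub (hγ0 : 0 ≤ γ) (hγ1 : γ ≤ 1) :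
    Tendsto (fun j => ∏ l ∈ range j, (1 - γ * (β l * gbar β g₀ l))) atTop
      (𝓝 ((gbarLim β g₀ / g₀) ^ γ / prodFactorLim β g₀ γ)) := by
  have hfun : (fun j => ∏ l ∈ range j, (1 - γ * (β l * gbar β g₀ l))) =
      fun j => (gbar β g₀ j / g₀) ^ γ / prodFactor β g₀ γ j := funext (h.prod_one_sub_eq hγ1)
  rw [hfun]
  refine Tendsto.div ?_ (h.tendsto_prodFactor hγ0 hγ1) (h.prodFactorLim_pos hγ0 hγ1).ne'
  exact ((h.tendsto_gbar_gbarLim).div_const g₀).rpow_const (Or.inr hγ0)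

end GbarHyp

/-! ### The `(g₀𝖡_{m²})^{-γ}` law: `(ḡ_∞/g₀)^γ (g₀Σ_jβ_j)^γ → 1` -/

/-- **`(ḡ_∞/g₀)^γ · (g₀Σ_jβ_j)^γ → 1`** along any family with `Σ_jβ_j → ∞`, `g₀ → ĝ₀ > 0` (and
`GbarHyp` throughout), for `γ ≥ 0`: with `tendsto_prod_one_sub`, the perturbative skeleton of
"`lim_N ν_N' ∼ c(ĝ₀)/(ĝ₀𝖡_{m²})^γ` as `(m², g₀) → (0, ĝ₀)`" (given `Σ_jβ_j = 𝖡_{m²} → ∞`, Lemma 8.3.1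
of the held text and (1.8)) — the origin of the exponent `γ = 1/4` of the logarithm in Theorem 1.1.
[cite: BauerschmidtBrydgesSlade2015LogCorr, §8.3 (lim_N ν_N' ∼ c(ĝ₀)/(ĝ₀𝖡_{m²})^γ)] -/
theorem tendsto_rpow_gbarLim_mul_tsum {ι : Type*} {l : Filter ι} {βf : ι → ℕ → ℝ} {B γ : ℝ}
    {g : ι → ℝ} {ĝ₀ : ℝ} (hh : ∀ i, GbarHyp (βf i) B (g i)) (hs : ∀ i, Summable (βf i))
    (hS : Tendsto (fun i => ∑' j, βf i j) l atTop) (hg : Tendsto g l (𝓝 ĝ₀)) (hĝ₀ : 0 < ĝ₀)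
    (hγ0 : 0 ≤ γ) :
    Tendsto (fun i => (gbarLim (βf i) (g i) / g i) ^ γ * (g i * ∑' j, βf i j) ^ γ) l (𝓝 1) := by
  have h1 := (tendsto_gbarLim_mul_tsum hh hs hS hg hĝ₀).rpow_const (p := γ) (Or.inr hγ0)
  rw [Real.one_rpow] at h1
  refine h1.congr fun i => ?_
  have hgi := (hh i).pos
  have hL := ((hh i).gbarLim_pos (hs i)).le
  have hSi := (hh i).tsum_beta_nonneg
  rw [← Real.mul_rpow (div_nonneg hL hgi.le) (mul_nonneg hgi.le hSi)]
  congr 1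
  field_simp

end CTWSAW

end Literature.Barriers.CriticalPhenomena
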